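import Summits.QuantumFields.QCD.Theorems.QuarksAsStableActionStableActionBridgeSoftClosureTensor
import Summits.QuantumFields.QCD.Theorems.GapBuysCauchyRateConvergentOSClosureStubGapTransfer
import Literature.MathematicalPhysics.QuantumFieldTheory.MassGapFromLatticeClustering
import HarnessLib

/-!
# Stub `stub_softClosure` of line `birth` — CORRECTED (shortened) signature
(crux `Summit.QuantumFields.QCD.Theses.GapBuysCauchyRate.ConvergentOSClosure`, item stmt-QuantumFields-11525,
route route-QuantumFields-GapBuysCauchyRate)

Why a corrected signature: the skeleton's `stub_softClosure` statement is 4816 characters; `ledger skeleton check`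
registers `sig[:3900]` and the gate refuses stub signatures `> 4000` characters, so the registered copy is a truncated,
unparseable prefix and `propose --supports` can never match it (`supports.stub-mismatch`, p148925/p149133).  This file
proves the SAME mathematics with the three packaging-only hypotheses (two calibrations, `κ₃` witness) and the packaging
conjunct removed — that conjunct is the landed `stub_speciesPackaging` applied to `⟨⟨h0, h0', ⟨hE1t, hRot⟩, hE2, hE3,
hE4⟩, hE0'⟩` in the skeleton's composition — and the scheme quantified as a bare `sch : QCDScheme Nf` (2893 characters).

## Summary

The SOFT OS CLOSURE of the crux, in the vocabulary of the sibling crux `StableActionBridge`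
(stmt-QuantumFields-9737) whose toolkit is landed (`Theorems/QuarksAsStableActionStableActionBridgeSoftClosure*`).
For a scheme `sch` and the canonical lattice distributions
`Λ k := qcdLatticeDist sch k` (a labelled Schwinger family for every `k`) we are GIVEN: convergence of the
honest lattice `n`-point functions `qcdLatticeSchwinger sch k` on off-diagonal real tensors, the
k-uniform E0′ bound on `⁰𝒮` (P2), asymptotic translation invariance (P6), eventually approximately
positive OS forms (P8), k-uniform spatial clustering (P9), the lattice gap at rate `Δ` and species
Cauchy–Schwarz clustering at rate `Δ'`.  We PRODUCE the conclusion of `ConvergentOSClosure` minus its packaging clause: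

1. convergence on all of `⁰𝒮` (`tendsto_qcdLatticeDist_of_tensor` + the landed totality theorem
   `stub_offDiagonalTensorDensity`), limit functionals by Hahn–Banach (`exists_labelled_tendsto`), and the
   identification of the limits of `qcdLatticeSchwinger` on real tensors (`qcdLatticeSchwinger_eq_qcdLatticeDist`);
2. inheritance of E0 / E0′ / translations / E2 / E3 / E4 along the limit (`…_of_labelled_tendsto`; E3 from the
   exact lattice symmetry `stub_permExact`), hermiticity from E2 + E0 (Kravchuk–Qiao–Rychkov Rem. 2.2, tree
   `osLegsC_isHermitian_of_isReflectionPositive`);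
3. the species gap BEFORE rotations: `HasSpeciesCSClustering Δ'` + convergence ⇒ `HasSpeciesDiagClustering Δ'`
   (the `T`-free form of `OSData.clustersDiag_of_clustersCS`), then the landed `stub_gapTransfer`; the common
   rate is `min Δ Δ'` by antitonicity of both gap predicates in the rate.

References: Osterwalder–Schrader II (CMP 42, 1975) §2, §4; Glimm–Jaffe, *Quantum Physics* (1987) §6.1
Thm. 6.1.3; Osterwalder–Seiler, Ann. Phys. 110 (1978) §§2–4.  No definitions, no named facts.
-/

noncomputable section

open scoped BigOperators Topology SchwartzMap ComplexConjugate
open MeasureTheory Filter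
open Literature.MathematicalPhysics.AQFT Literature.MathematicalPhysics.QuantumLattice
  Literature.MathematicalPhysics.QuantumFieldTheory
open Summit.QuantumFields.QCD.Cruxes.StableActionBridge.Sketch

namespace Summit.QuantumFields.QCD.Theorems.ConvergentOSClosure

/-! ## Three small tools -/

/-- **`ClustersCS ⇒ ClustersDiag` along ANY convergent lattice approximation** (`T`-free form of
`OSData.clustersDiag_of_clustersCS`): if every `Λ k n σ f` converges on off-diagonal real product tensors
(`n ≥ 1`) then the diagonal lattice OS "norm" `Λᵏ₂ₙ(θpʳ ++ p)` of a slab-ordered datum is eventually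
bounded by `‖lim‖ + 1`, and the `N = N' = 1`, `c = 1` instance of `ClustersCS` gives `ClustersDiag` with
that free constant (Glimm–Jaffe 1987, §6.1 Thm. 6.1.3; Osterwalder–Seiler 1978, §§2–4). -/
private theorem clustersDiag_of_clustersCS_of_tendsto_soft {ι : Type} {d : ℕ} [NeZero d]
    (Λ : ℕ → (n : ℕ) → (Fin n → ι) → (Fin n → 𝓢(EuclideanSpace ℝ (Fin d), ℝ)) → ℂ)
    (hΛ : ∀ (n : ℕ), n ≠ 0 → ∀ (σ : Fin n → ι) (f : Fin n → 𝓢(EuclideanSpace ℝ (Fin d), ℝ))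
      (F : 𝓢((Fin n → EuclideanSpace ℝ (Fin d)), ℂ)), IsTensorOf F (fun i => ofRealTest (f i)) →
      IsOffDiagonal F → ∃ c : ℂ, Tendsto (fun k => Λ k n σ f) atTop (𝓝 c))
    {Δ : ℝ} (h : ClustersCS d Λ Δ) : ClustersDiag d Λ Δ := by
  -- adapted from `OSData.clustersDiag_of_clustersCS` (Literature `DiagonalLatticeClustering`)
  intro n hn σ p hp
  obtain ⟨P, hP⟩ : ∃ P : 𝓢((Fin n → EuclideanSpace ℝ (Fin d)), ℂ),
      IsTensorOf P (fun l => ofRealTest (p l)) := exists_isTensorOf _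
  have hPt : IsTimeOrdered P :=
    IsTimeOrdered.of_mem_slabOrderedProducts (hp.mem_slabOrderedProducts hP)
  -- the lattice OS "norm" converges (to some `D`), hence is eventually bounded by `‖D‖ + 1`
  obtain ⟨D, hD⟩ : ∃ D : ℂ, Tendsto (fun k => Λ k (n + n) (Fin.append (σ ∘ Fin.rev) σ)
        (Fin.append (fun l => thetaTest d (p (Fin.rev l))) p)) atTop (𝓝 D) := by
    refine hΛ (n + n) (by omega) _ _ ((osAdjoint P).appendTensor P) ?_ ?_
    · have h1 := hP.osAdjoint.appendTensor hP
      rwa [append_ofRealTest] at h1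
    · exact OSReconstructionNoE1.isOffDiagonal_appendTensor_osAdjoint hPt hPt
  set V : ℝ := ‖D‖ with hV
  have hDn : ∀ᶠ k in atTop, ‖Λ k (n + n) (Fin.append (σ ∘ Fin.rev) σ)
      (Fin.append (fun l => thetaTest d (p (Fin.rev l))) p)‖ ≤ V + 1 :=
    (hD.norm.eventually (Iio_mem_nhds (by linarith : V < V + 1))).mono fun k hk => hk.le
  refine ⟨V + 1, fun t ht ε hε => ?_⟩
  have hcs := h n n hn hn σ σ 1 1 (fun _ => 1) (fun _ => 1) (fun _ => p) (fun _ => p)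
    (fun _ => hp) (fun _ => hp) t ht ε hε
  filter_upwards [hcs, hDn] with k hk hk'
  have hk1 : ‖Λ k (n + n) (Fin.append (σ ∘ Fin.rev) σ)
        (Fin.append (fun l => thetaTest d (p (Fin.rev l)))
          (fun l => translateTest (EuclideanSpace.single 0 t) (p l))) -
        Λ k n (σ ∘ Fin.rev) (fun l => thetaTest d (p (Fin.rev l))) * Λ k n σ p‖ ≤
      Real.exp (-Δ * t) *
        Real.sqrt ‖Λ k (n + n) (Fin.append (σ ∘ Fin.rev) σ)
          (Fin.append (fun l => thetaTest d (p (Fin.rev l))) p)‖ *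
        Real.sqrt ‖Λ k (n + n) (Fin.append (σ ∘ Fin.rev) σ)
          (Fin.append (fun l => thetaTest d (p (Fin.rev l))) p)‖ + ε := by
    simpa only [Fin.sum_univ_one, map_one, one_mul] using hk
  have hsq : Real.sqrt ‖Λ k (n + n) (Fin.append (σ ∘ Fin.rev) σ)
          (Fin.append (fun l => thetaTest d (p (Fin.rev l))) p)‖ *
        Real.sqrt ‖Λ k (n + n) (Fin.append (σ ∘ Fin.rev) σ)
          (Fin.append (fun l => thetaTest d (p (Fin.rev l))) p)‖ ≤ V + 1 := by
    rw [Real.mul_self_sqrt (norm_nonneg _)]; exact hk'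
  have hexp : 0 ≤ Real.exp (-Δ * t) := (Real.exp_pos _).le
  calc _ ≤ _ := hk1
    _ ≤ (V + 1) * Real.exp (-Δ * t) + ε := by
        rw [mul_assoc]; nlinarith [mul_le_mul_of_nonneg_left hsq hexp]

/-- **Antitonicity of the labelled gap in the rate**: a gap `Δ` is a gap `Δ₀ ≤ Δ` (replace the constant
`C` by `max C 0`, and `e^{−Δt} ≤ e^{−Δ₀t}` for `t ≥ 0`). -/
private theorem hasMassGap_anti_soft {ι : Type} {d : ℕ} [NeZero d]
    {S : LabelledSchwingerFamily ι (EuclideanSpace ℝ (Fin d))} {Δ Δ₀ : ℝ}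
    (h : S.HasMassGap Δ) (hle : Δ₀ ≤ Δ) : S.HasMassGap Δ₀ := by
  -- adapted from `hasMassGap_anti` (Cruxes/SeaFactorisationBridge/Lines/proper_time_quarantine)
  intro n n' k k' F G hF hG
  obtain ⟨C, hC⟩ := h n n' k k' F G hF hG
  refine ⟨max C 0, fun t ht H hH => (hC t ht H hH).trans ?_⟩
  have h1 : Real.exp (-Δ * t) ≤ Real.exp (-Δ₀ * t) :=
    Real.exp_le_exp.2 (by nlinarith [mul_le_mul_of_nonneg_right hle ht])
  calc C * Real.exp (-Δ * t) ≤ max C 0 * Real.exp (-Δ * t) :=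
        mul_le_mul_of_nonneg_right (le_max_left _ _) (Real.exp_nonneg _)
    _ ≤ max C 0 * Real.exp (-Δ₀ * t) := mul_le_mul_of_nonneg_left h1 (le_max_right _ _)

/-- **Antitonicity of the uniform lattice gap in the rate**: `sch.HasLatticeMassGap Δ → sch.HasLatticeMassGap Δ₀`
for `Δ₀ ≤ Δ` (lattice spacings are positive, so `e^{−Δ aₖ n} ≤ e^{−Δ₀ aₖ n}`; constant `max C 0`). -/
private theorem hasLatticeMassGap_anti_soft {Nf : ℕ} {sch : QCDScheme Nf} {Δ Δ₀ : ℝ}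
    (h : sch.HasLatticeMassGap Δ) (hle : Δ₀ ≤ Δ) : sch.HasLatticeMassGap Δ₀ := by
  -- adapted from `hasLatticeMassGap_anti` (Cruxes/SeaFactorisationBridge/Lines/proper_time_quarantine)
  intro R R' A B
  obtain ⟨C, hC⟩ := h R R' A B
  refine ⟨max C 0, ?_⟩
  filter_upwards [hC] with k hk L hL n hn
  refine (hk L hL n hn).trans ?_
  have hx : 0 ≤ sch.a k * n := mul_nonneg (sch.a_pos k).le (Nat.cast_nonneg n)
  have h1 : Real.exp (-(Δ * (sch.a k * n))) ≤ Real.exp (-(Δ₀ * (sch.a k * n))) :=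
    Real.exp_le_exp.2 (neg_le_neg (mul_le_mul_of_nonneg_right hle hx))
  calc C * Real.exp (-(Δ * (sch.a k * n))) ≤ max C 0 * Real.exp (-(Δ * (sch.a k * n))) :=
        mul_le_mul_of_nonneg_right (le_max_left _ _) (Real.exp_nonneg _)
    _ ≤ max C 0 * Real.exp (-(Δ₀ * (sch.a k * n))) := mul_le_mul_of_nonneg_left h1 (le_max_right _ _)

/-! ## The stub -/

/-- **(SOFT′) Soft OS closure modulo rotations and packaging** of the crux `ConvergentOSClosure` (line `birth`).
For a lattice QCD scheme `sch`: convergence of the lattice `n`-point functions on off-diagonal real tensors, the k-uniform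
E0′ bound on `⁰𝒮` (P2), asymptotic translation invariance (P6), eventually approximately positive OS forms
(P8), k-uniform spatial clustering (P9), the uniform lattice gap at rate `Δ` and species Cauchy–Schwarz
clustering at rate `Δ'` give a labelled Schwinger family `S` — the Hahn–Banach limit of the canonical
lattice distributions `qcdLatticeDist sch k` on `⁰𝒮` — with E0, E0′, translation invariance, E2, E3, E4, the limit
clause on real tensors and the common gap `min Δ Δ'` (continuum AND lattice)
(Osterwalder–Schrader II 1975, §2, §4; Glimm–Jaffe 1987, §6.1). -/
theorem stub_softClosure : ∀ (Nf : ℕ) (sch : QCDScheme Nf), (∀ n : ℕ, n ≠ 0 → ∀ (σ : Fin n → QCDField Nf) (f : Fin n → SchwartzMap (EuclideanSpace ℝ (Fin 4)) ℝ) (F : SchwartzMap (Fin n → EuclideanSpace ℝ (Fin 4)) ℂ), IsTensorOf F (fun i => ofRealTest (f i)) → IsOffDiagonal F → ∃ c : ℂ, Filter.Tendsto (fun k : ℕ => qcdLatticeSchwinger sch k n σ f) Filter.atTop (nhds c)) → ∀ (s : ℕ) (α β : ℝ), 0 ≤ α → (∀ (n : ℕ) (σ : Fin n → QCDField Nf),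 ∀ᶠ k in Filter.atTop, ∀ F : SchwartzMap (Fin n → EuclideanSpace ℝ (Fin 4)) ℂ, IsOffDiagonal F → ‖qcdLatticeDist sch k n σ F‖ ≤ α * (n.factorial : ℝ) ^ β * schwartzNorm (n * s) F) → (∀ (n : ℕ) (σ : Fin n → QCDField Nf) (a : EuclideanSpace ℝ (Fin 4)) (F : SchwartzMap (Fin n → EuclideanSpace ℝ (Fin 4)) ℂ), IsOffDiagonal F → Filter.Tendsto (fun k : ℕ => qcdLatticeDist sch k n σ (translateMulti a F) - qcdLatticeDist sch k n σ F) Filter.atTop (nhds 0)) → (∀ (N : ℕ) (deg : Fin N → ℕ) (lab : (j : Fin N) → Fin (deg j) → QCDField Nf) (G : (j : Fin N) → SchwartzMap (Fin (deg j) → EuclideanSpace ℝ (Fin 4)) ℂ), (∀ j, IsTimeOrdered (G j)) → ∀ H : (i j : Fin N) → SchwartzMap (Fin (deg i + deg j) → EuclideanSpace ℝ (Fin 4)) ℂ, (∀ i j, IsAppendTensorOf (H i j) (osAdjoint (G i)) (G j)) → ∀ ε : ℝ, 0 < ε → ∀ᶠ l in Filter.atTop, -ε ≤ (∑ i, ∑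 j, qcdLatticeDist sch l (deg i + deg j) (Fin.append (lab i ∘ Fin.rev) (lab j)) (H i j)).re ∧ |(∑ i, ∑ j, qcdLatticeDist sch l (deg i + deg j) (Fin.append (lab i ∘ Fin.rev) (lab j)) (H i j)).im| ≤ ε) → (∀ (n n' : ℕ) (σ : Fin n → QCDField Nf) (σ' : Fin n' → QCDField Nf) (F : SchwartzMap (Fin n → EuclideanSpace ℝ (Fin 4)) ℂ) (G : SchwartzMap (Fin n' → EuclideanSpace ℝ (Fin 4)) ℂ), IsTimeOrdered F → IsTimeOrdered G → ∀ a : EuclideanSpace ℝ (Fin 4), a 0 = 0 → a ≠ 0 → ∀ ε : ℝ, 0 < ε → ∃ t₀ : ℝ, ∀ t : ℝ, t₀ ≤ t → ∀ H : SchwartzMap (Fin (n + n') → EuclideanSpace ℝ (Fin 4)) ℂ, IsAppendTensorOf H (osAdjoint F) (translateMulti (t • a) G) → ∀ᶠ k in Filter.atTop, ‖qcdLatticeDist sch k (n + n') (Fin.append (σ ∘ Fin.rev) σ') H - qcdLatticeDist sch k n (σ ∘ Fin.rev) (osAdjoint F) * qcdLatticeDist sch k n' σ' G‖ ≤ ε)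 → ∀ (Δ Δ' : ℝ), 0 < Δ → 0 < Δ' → sch.HasLatticeMassGap Δ → sch.HasSpeciesCSClustering Δ' → ∃ S : LabelledSchwingerFamily (QCDField Nf) (EuclideanSpace ℝ (Fin 4)), S.IsNormalized ∧ S.IsHermitian ∧ S.HasLinearGrowth ∧ (∀ (n : ℕ) (σ : Fin n → QCDField Nf) (a : EuclideanSpace ℝ (Fin 4)) (F : SchwartzMap (Fin n → EuclideanSpace ℝ (Fin 4)) ℂ), IsOffDiagonal F → S n σ (translateMulti a F) = S n σ F) ∧ S.IsReflectionPositive ∧ S.IsSymmetric ∧ S.HasClusterProperty ∧ (∀ n : ℕ, n ≠ 0 → ∀ (σ : Fin n → QCDField Nf) (f : Fin n → SchwartzMap (EuclideanSpace ℝ (Fin 4)) ℝ) (F : SchwartzMap (Fin n → EuclideanSpace ℝ (Fin 4)) ℂ), IsTensorOf F (fun i => ofRealTest (f i)) → IsOffDiagonal F → Filter.Tendsto (fun k : ℕ => qcdLatticeSchwinger sch k n σ f) Filter.atTop (nhds (S n σ F))) ∧ (∃ Δ : ℝ, 0 < Δ ∧ S.HasMassGap Δ ∧ sch.HasLatticeMassGap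 Δ) := by
  intro Nf sch hLIM s α β hα hb hP6 hP8 hP9 Δ Δ' hΔ hΔ' hgap hCS
  -- (1) convergence on all of `⁰𝒮` (ε/3 with the k-uniform E0′ bound and the totality of off-diagonal tensors)
  have hconv : ∀ (n : ℕ) (σ : Fin n → QCDField Nf) (F : 𝓢((Fin n → EuclideanSpace ℝ (Fin 4)), ℂ)),
      IsOffDiagonal F → ∃ c : ℂ, Tendsto (fun k => qcdLatticeDist sch k n σ F) atTop (𝓝 c) :=
    tendsto_qcdLatticeDist_of_tensor sch stub_offDiagonalTensorDensity hb hLIM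
  -- (2) the limit family on `⁰𝒮`, with the E0′ bound everywhere
  obtain ⟨S, hS, hSb⟩ := exists_labelled_tendsto (fun k => qcdLatticeDist sch k)
    (fun n => α * (n.factorial : ℝ) ^ β) (fun n => n * s) (fun n => by positivity) hb hconv
  -- (3) the honest lattice `n`-point functions converge to `S` on off-diagonal real tensors
  have htensor : ∀ n : ℕ, n ≠ 0 → ∀ (σ : Fin n → QCDField Nf)
      (f : Fin n → SchwartzMap (EuclideanSpace ℝ (Fin 4)) ℝ) (F : SchwartzMap (Fin n → EuclideanSpace ℝ (Fin 4)) ℂ),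
      IsTensorOf F (fun i => ofRealTest (f i)) → IsOffDiagonal F →
      Filter.Tendsto (fun k : ℕ => qcdLatticeSchwinger sch k n σ f) Filter.atTop (nhds (S n σ F)) := by
    intro n hn σ f F hF hoff
    refine (hS n σ F hoff).congr' (Eventually.of_forall fun k => ?_)
    exact qcdLatticeSchwinger_eq_qcdLatticeDist sch k n hn σ f F hF
  -- (4) the axioms of `S`
  have h0 : S.IsNormalized :=
    isNormalized_of_labelled_tendsto hS
      (Eventually.of_forall fun k => isNormalized_qcdLatticeDist sch k)
  have hE0' : S.HasLinearGrowth :=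
    hasLinearGrowth_of_labelled_bound S s α β fun n k F _ => hSb n k F
  have hE1t : ∀ (n : ℕ) (σ : Fin n → QCDField Nf) (a : EuclideanSpace ℝ (Fin 4))
      (F : SchwartzMap (Fin n → EuclideanSpace ℝ (Fin 4)) ℂ), IsOffDiagonal F →
      S n σ (translateMulti a F) = S n σ F :=
    translate_eq_of_labelled_tendsto hS hP6
  have hE2 : S.IsReflectionPositive := isReflectionPositive_of_labelled_tendsto hS hP8
  -- E0-hermiticity is a consequence of E2 and E0-normalisation (Kravchuk–Qiao–Rychkov Rem. 2.2; tree, YM OSLegsC)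
  have h0' : S.IsHermitian :=
    Summit.QuantumFields.YangMills.Cruxes.ContinuumLimitOnTrajectory.TwoOrbitSynchronisation.osLegsC_isHermitian_of_isReflectionPositive
      S hE2 h0
  -- E3 from the EXACT lattice symmetry `stub_permExact`
  have hsymm : ∀ (n : ℕ) (σ : Fin n → QCDField Nf) (π : Equiv.Perm (Fin n))
      (F : SchwartzMap (Fin n → EuclideanSpace ℝ (Fin 4)) ℂ), IsOffDiagonal F →
      Tendsto (fun k => qcdLatticeDist sch k n σ (permTest π F) -
        qcdLatticeDist sch k n (σ ∘ π) F) atTop (𝓝 0) := by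
    intro n σ π F _
    have hzero : (fun k => qcdLatticeDist sch k n σ (permTest π F) -
        qcdLatticeDist sch k n (σ ∘ π) F) = fun _ => 0 :=
      funext fun k => by rw [stub_permExact, sub_self]
    rw [hzero]
    exact tendsto_const_nhds
  have hE3 : S.IsSymmetric := isSymmetric_of_labelled_tendsto hS hsymm
  have hE4 : S.HasClusterProperty := hasClusterProperty_of_labelled_tendsto hS hP9
  -- (5) the species gap BEFORE rotations: CS clustering ⇒ diagonal clustering ⇒ `S.HasMassGap Δ'`
  have hDiag : sch.HasSpeciesDiagClustering Δ' :=
    clustersDiag_of_clustersCS_of_tendsto_soft (qcdLatticeSchwinger sch) hLIM hCS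
  have hGap' : S.HasMassGap Δ' :=
    stub_gapTransfer Nf sch Δ' S h0 hE1t hE2 hE4 htensor hDiag
  have hGap₀ : S.HasMassGap (min Δ Δ') := hasMassGap_anti_soft hGap' (min_le_right Δ Δ')
  have hLgap₀ : sch.HasLatticeMassGap (min Δ Δ') :=
    hasLatticeMassGap_anti_soft hgap (min_le_left Δ Δ')
  -- (6) the conclusion, in the crux's order
  exact ⟨S, h0, h0', hE0', hE1t, hE2, hE3, hE4, htensor, min Δ Δ', lt_min hΔ hΔ', hGap₀, hLgap₀⟩

end Summit.QuantumFields.QCD.Theorems.ConvergentOSClosure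

end
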